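import Literature.NumberTheory.GaloisRepresentations.CompletionCompositumEmbedding
import Literature.NumberTheory.GaloisRepresentations.AbsGaloisGroupCompact
import HarnessLib

/-!
# Coset decomposition of an arbitrary Galois element along a tower with levelwise coset completeness

For a number field `K`, a finite place `v`, a monotone tower `S₀ ≤ S₁ ≤ …` of finite Galois subextensions of `K̄/K` and
representatives `t_j ∈ Γ_K` (`j ∈ J`) such that at EVERY level `j ↦ t_j|_{S_n} · 𝔓_n` is a bijection onto the places of `S_n` above `v`
(`𝔓_n` the place cut out by the fixed embedding `K̄ → K̄_v`), every `g ∈ Γ_K` decomposes UNIFORMLY in `n` as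
`g|_{S_n} = (t_k · res δ̃)|_{S_n}` with ONE index `k ∈ J` and ONE local element `δ̃ ∈ Γ_{K_v}` (`res : Γ_{K_v} → Γ_K` the decomposition
embedding).  Ingredients: the decomposition group of `𝔓_n` is the image of `Γ_{K_v}` (`exists_restrict_of_smul_embPlace_eq`,
`smul_embPlace_eq`), so "`ρ` fixes `𝔓_{n+1}`" descends to level `n` and the index `k_n` is constant; the local elements realising
`t_k⁻¹g` on `S_n` form nested non-empty closed subsets of the compact group `Γ_{K_v}`, whose intersection is non-empty.
This is the Shapiro bookkeeping behind de Shalit III §1.8 (14) / Rubin §4 for an arbitrary (not necessarily decomposition-liftable)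
Artin symbol.

* `smul_embPlace_eq_of_succ` — fixing `𝔓_{n+1}` implies fixing `𝔓_n`;
* ★ `exists_forall_smul_embPlace_eq` — one index `k` with `g|_{S_n}·𝔓_n = t_k|_{S_n}·𝔓_n` for all `n`;
* ★★ `exists_index_local_of_coset_complete` — **`∃ k δ̃, ∀ n, g|_{S_n} = (t_k · res δ̃)|_{S_n}`**.

## References
* [CasselsFrohlichANT1967] J. W. S. Cassels, A. Fröhlich (eds.), *Algebraic Number Theory* (1967), Ch. VII (Tate) §1.1, Prop. 1.2.
* [Brown1982] K. S. Brown, *Cohomology of Groups* (1982), III (5.8), (6.2).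
* [deShalit1987] E. de Shalit, *Iwasawa theory of elliptic curves with complex multiplication* (1987), III §1.8 (14).
-/

noncomputable section

open NumberField IsDedekindDomain Field
open scoped Pointwise

namespace Literature.NumberTheory.GaloisRepresentations

namespace SemiLocal

variable {K : Type} [Field K] [NumberField K] (v : HeightOneSpectrum (𝓞 K))
  (S : ℕ → IntermediateField K (AlgebraicClosure K)) [∀ n, NumberField (S n)] [∀ n, IsGalois K (S n)]

omit [NumberField K] in
/-- `((ρ|_L) y : K̄) = ρ • y` (bookkeeping). [folklore] -/
private theorem coe_absRestrictNormalHom_apply₃₂ (L : IntermediateField K (AlgebraicClosure K)) [Normal K L]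
    (ρ : absoluteGaloisGroup K) (y : L) :
    ((absRestrictNormalHom L ρ y : L) : AlgebraicClosure K) = ρ • (y : AlgebraicClosure K) :=
  AlgEquiv.restrictNormalHom_apply L _ y

omit [NumberField K] in
/-- Agreement on `L'` restricts to agreement on `L ≤ L'` (bookkeeping). [folklore] -/
private theorem absRestrictNormalHom_eq_of_le₃₂ {L L' : IntermediateField K (AlgebraicClosure K)} [Normal K L] [Normal K L']
    (hLL' : L ≤ L') {ρ ρ' : absoluteGaloisGroup K} (h : absRestrictNormalHom L' ρ = absRestrictNormalHom L' ρ') :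
    absRestrictNormalHom L ρ = absRestrictNormalHom L ρ' := by
  ext y
  have e := congrArg (fun s : L' ≃ₐ[K] L' ↦ ((s ⟨(y : AlgebraicClosure K), hLL' y.2⟩ : L') : AlgebraicClosure K)) h
  simp only [coe_absRestrictNormalHom_apply₃₂] at e
  rw [coe_absRestrictNormalHom_apply₃₂, coe_absRestrictNormalHom_apply₃₂]
  exact e

/-- A local element realising `ρ` on `S_n` makes `ρ|_{S_n}` fix `𝔓_n`. [cite: CasselsFrohlichANT1967, Ch. VII §1.1] -/
theorem smul_embPlace_eq_of_forall_coe_eq (n : ℕ) {ρ : absoluteGaloisGroup K} {d : absoluteGaloisGroup (v.adicCompletion K)}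
    (hd : ∀ e : S n, ρ • (e : AlgebraicClosure K) = absGaloisRestrict K (v.adicCompletion K) d • (e : AlgebraicClosure K)) :
    absRestrictNormalHom (S n) ρ • embPlace v (S n).val = embPlace v (S n).val :=
  smul_embPlace_eq v (S n).val fun e ↦ by
    change ((absRestrictNormalHom (S n) ρ e : S n) : AlgebraicClosure K) = absGaloisRestrict K (v.adicCompletion K) d • (e : AlgebraicClosure K)
    rw [coe_absRestrictNormalHom_apply₃₂, hd e]

/-- Conversely, if `ρ|_{S_n}` fixes `𝔓_n` then a local element realises `ρ` on `S_n`. [cite: CasselsFrohlichANT1967, Ch. VII §1.1, Prop. 1.2] -/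
theorem exists_forall_coe_eq_of_smul_embPlace_eq (n : ℕ) {ρ : absoluteGaloisGroup K}
    (h : absRestrictNormalHom (S n) ρ • embPlace v (S n).val = embPlace v (S n).val) :
    ∃ d : absoluteGaloisGroup (v.adicCompletion K),
      ∀ e : S n, ρ • (e : AlgebraicClosure K) = absGaloisRestrict K (v.adicCompletion K) d • (e : AlgebraicClosure K) := by
  obtain ⟨d, hd⟩ := exists_restrict_of_smul_embPlace_eq v (S n).val h
  refine ⟨d, fun e ↦ ?_⟩
  rw [← coe_absRestrictNormalHom_apply₃₂ (S n) ρ e]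
  exact hd e

/-- **Descent of fixing**: if `ρ|_{S_{n+1}}` fixes `𝔓_{n+1}` then `ρ|_{S_n}` fixes `𝔓_n` (`S_n ≤ S_{n+1}`; the decomposition group is the image of
`Γ_{K_v}` at both levels). [cite: CasselsFrohlichANT1967, Ch. VII §1.1, Prop. 1.2] -/
theorem smul_embPlace_eq_of_succ (hS : Monotone S) (n : ℕ) {ρ : absoluteGaloisGroup K}
    (h : absRestrictNormalHom (S (n + 1)) ρ • embPlace v (S (n + 1)).val = embPlace v (S (n + 1)).val) :
    absRestrictNormalHom (S n) ρ • embPlace v (S n).val = embPlace v (S n).val := by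
  obtain ⟨d, hd⟩ := exists_forall_coe_eq_of_smul_embPlace_eq v S (n + 1) h
  exact smul_embPlace_eq_of_forall_coe_eq v S n fun e ↦ hd ⟨(e : AlgebraicClosure K), hS (Nat.le_succ n) e.2⟩

/-- Descent of fixing along `m ≤ n`. [cite: CasselsFrohlichANT1967, Ch. VII §1.1] -/
theorem smul_embPlace_eq_of_le (hS : Monotone S) {m n : ℕ} (hmn : m ≤ n) {ρ : absoluteGaloisGroup K}
    (h : absRestrictNormalHom (S n) ρ • embPlace v (S n).val = embPlace v (S n).val) :
    absRestrictNormalHom (S m) ρ • embPlace v (S m).val = embPlace v (S m).val := by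
  induction n, hmn using Nat.le_induction with
  | base => exact h
  | succ n _ ih => exact ih (smul_embPlace_eq_of_succ v S hS n h)

variable {J : Type} (t : J → absoluteGaloisGroup K)
  (H1 : ∀ n : ℕ, Function.Bijective fun j : J ↦ absRestrictNormalHom (S n) (t j) • embPlace v (S n).val)

/-- `g|_{S_n}·𝔓_n = t_k|_{S_n}·𝔓_n` iff `(t_k⁻¹g)|_{S_n}` fixes `𝔓_n` (bookkeeping in the `Gal(S_n/K)`-set of places). [cite: CasselsFrohlichANT1967, Ch. VII §1.1] -/
theorem smul_embPlace_eq_iff_inv_mul (n : ℕ) (g : absoluteGaloisGroup K) (k : J) :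
    absRestrictNormalHom (S n) g • embPlace v (S n).val = absRestrictNormalHom (S n) (t k) • embPlace v (S n).val ↔
      absRestrictNormalHom (S n) ((t k)⁻¹ * g) • embPlace v (S n).val = embPlace v (S n).val := by
  rw [map_mul, map_inv, mul_smul, inv_smul_eq_iff]

include H1 in
/-- ★ **One index for all levels**: there is `k ∈ J` with `g|_{S_n}·𝔓_n = t_k|_{S_n}·𝔓_n` for EVERY `n` (surjectivity gives `k_n`; `k_{n+1}` works at
level `n` by descent, so `k_n = k_{n+1}` by injectivity). [cite: Brown1982, III (5.8)] [cite: CasselsFrohlichANT1967, Ch. VII §1.1] -/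
theorem exists_forall_smul_embPlace_eq (hS : Monotone S) (g : absoluteGaloisGroup K) :
    ∃ k : J, ∀ n : ℕ, absRestrictNormalHom (S n) g • embPlace v (S n).val = absRestrictNormalHom (S n) (t k) • embPlace v (S n).val := by
  -- levelwise indices
  choose kOf hkOf using fun n ↦ (H1 n).2 (absRestrictNormalHom (S n) g • embPlace v (S n).val)
  -- `k_n` works at every level `m ≤ n`
  have hdown : ∀ m n, m ≤ n → absRestrictNormalHom (S m) g • embPlace v (S m).val = absRestrictNormalHom (S m) (t (kOf n)) • embPlace v (S m).val := by
    intro m n hmn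
    rw [smul_embPlace_eq_iff_inv_mul]
    exact smul_embPlace_eq_of_le v S hS hmn ((smul_embPlace_eq_iff_inv_mul v S t n g (kOf n)).mp (hkOf n).symm)
  -- hence `k_n = k_0`
  have hconst : ∀ n, kOf n = kOf 0 := fun n ↦ (H1 0).1 (((hdown 0 n (Nat.zero_le n)).symm.trans (hkOf 0).symm))
  exact ⟨kOf 0, fun n ↦ by rw [← hconst n]; exact (hkOf n).symm⟩

include H1 in
/-- ★★ **COSET DECOMPOSITION OF AN ARBITRARY GALOIS ELEMENT**: under levelwise coset completeness, every `g ∈ Γ_K` satisfies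
**`g|_{S_n} = (t_k · res δ̃)|_{S_n}` for all `n`**, for ONE `k ∈ J` and ONE `δ̃ ∈ Γ_{K_v}` — the local realisations of `t_k⁻¹g` on the `S_n` are nested
non-empty closed subsets of the compact `Γ_{K_v}`. [cite: CasselsFrohlichANT1967, Ch. VII §1.1, Prop. 1.2] [cite: Brown1982, III (5.8), (6.2)]
[cite: deShalit1987, III §1.8 (14)] -/
theorem exists_index_local_of_coset_complete (hS : Monotone S) (g : absoluteGaloisGroup K) :
    ∃ (k : J) (δ : absoluteGaloisGroup (v.adicCompletion K)), ∀ n : ℕ,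
      absRestrictNormalHom (S n) g = absRestrictNormalHom (S n) (t k * absGaloisRestrict K (v.adicCompletion K) δ) := by
  obtain ⟨k, hk⟩ := exists_forall_smul_embPlace_eq v S t H1 hS g
  -- the nested closed sets of local realisations
  set D : ℕ → Set (absoluteGaloisGroup (v.adicCompletion K)) := fun n ↦
    {δ | absRestrictNormalHom (S n) (absGaloisRestrict K (v.adicCompletion K) δ) = absRestrictNormalHom (S n) ((t k)⁻¹ * g)} with hD
  have hne : ∀ n, (D n).Nonempty := by
    intro n
    obtain ⟨d, hd⟩ := exists_forall_coe_eq_of_smul_embPlace_eq v S n ((smul_embPlace_eq_iff_inv_mul v S t n g k).mp (hk n))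
    refine ⟨d, ?_⟩
    simp only [hD, Set.mem_setOf_eq]
    ext e
    rw [coe_absRestrictNormalHom_apply₃₂, coe_absRestrictNormalHom_apply₃₂, hd e]
  have hmono : ∀ n, D (n + 1) ⊆ D n := fun n δ hδ ↦ absRestrictNormalHom_eq_of_le₃₂ (hS (Nat.le_succ n)) hδ
  have hcl : ∀ n, IsClosed (D n) := fun n ↦
    isClosed_eq ((InfiniteGalois.restrictNormalHom_continuous (k := K) (K := AlgebraicClosure K) (S n)).comp
      (absGaloisRestrict K (v.adicCompletion K)).continuous) continuous_const
  haveI : CompactSpace (absoluteGaloisGroup (v.adicCompletion K)) := absoluteGaloisGroup_compactSpace (v.adicCompletion K)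
  obtain ⟨δ, hδ⟩ := IsCompact.nonempty_iInter_of_sequence_nonempty_isCompact_isClosed D hmono hne (hcl 0).isCompact hcl
  refine ⟨k, δ, fun n ↦ ?_⟩
  have hn : δ ∈ D n := Set.mem_iInter.mp hδ n
  simp only [hD, Set.mem_setOf_eq] at hn
  rw [map_mul, hn, ← map_mul, mul_inv_cancel_left]

end SemiLocal

end Literature.NumberTheory.GaloisRepresentations

end
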